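import Summits.CriticalPhenomena.PercolationContinuityZ3.Theorems.PercNearOneGluingNoHeavyLowerTailQuantitativeBHKBlockingLevel
import HarnessLib

/-!
# The blocking floor for the two-cluster repulsion (quantitative BHK Thm 1.4 / eq. (2), «(blk)» member, layer-cake form)

Support file (`--supports stmt-CriticalPhenomena-4575`), prover seat `prim-rate-mine-2` (lane prim-rate, constants-miner (c), BENCH row
M2-R11 (blk); `run/shared/lean/prim/prim-rate/prim-rate-mine-2/CANDIDATES.md` §gen-2, PROOFS.md §P8–P10).  No definitions, no named facts,
no sorries; standard axioms.  Setting as in `condCov_level_openConn_ge_blocking`: weights supported on a pair set `E`, `D = {s ↮ t}`, `s ≠ t`,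
vertices `a, o`, the blocking potential `φ = −P_{C_s}(t↔o) ∈ [−1, 0]` and the level-`r` hull event `H_r` (`φ ≤ r`, `a ∉ C_s`, and every
extension `U` attached to `C_s` by pairs of `E` avoiding `t` with `φ_U > r` contains `a`).  Integrating the level floors over `r ∈ (−1, 0]`
(`φ(ω) + 1 = ∫_{(−1,0]} 1{r < φ(ω)} dr`) and using BHK's display (10) (`∫_D 1_A·P_{C_s}(t↔o) dμ = μ(D ∩ A ∩ {t↔o})` for `A` an increasing
`C_s`-event) gives the (blk) floor AS TYPED, in layer-cake form:

  `∫_{(−1,0]} μ(D ∩ {φ > r})·μ(D ∩ H_r) dr ≤ μ(D ∩ {s↔a})·μ(D ∩ {t↔o}) − μ(D)·μ(D ∩ {s↔a} ∩ {t↔o})`,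

i.e. `−Cov(1{s↔a}, 1{t↔o} | s↮t) ≥ ∫ ν(φ > r) ν(H_r) dr = Σ_r (r⁺ − r)·ν(φ > r)·ν(H_r)` (the integrand is constant between consecutive values
of `φ`), «blocking t ↔ o beyond level r FORCES absorbing a» — `QuantBHK.twoCluster_repulsion_openConn_ge_blocking`.  Together with the
attachment member (`…QuantitativeBHKAttachment.lean`) and the symmetric instances `(s,a) ↔ (t,o)` this puts the whole floor family
`FL = max(att, blk, att', blk')` of BENCH row M2-R11 in the kernel.
[cite: VandenbergHaggstromKahn2005, Thm. 1.3 (p. 6), Thm. 1.4 and eq. (2) (pp. 2, 7), display (10) (p. 7)]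
-/

noncomputable section

namespace Summit.CriticalPhenomena.PercolationContinuityZ3.Theorems

open MeasureTheory Set Literature.Probability.LatticeModels Literature.Probability.Percolation
open scoped Classical
open Literature.Probability.Percolation.BHK2006 DecisionTree

namespace QuantBHK

universe v

variable {V : Type v} [Fintype V]

/-! ### Layer cake over the levels: the (blk) floor for the two-cluster repulsion -/

/-- `∫_{(-1,0]} 1{r < c} dr = c + 1` for `c ∈ [-1, 0]`. [folklore] -/
theorem integral_Ioc_ite_lt_eq (c : ℝ) (hc1 : -1 ≤ c) (hc0 : c ≤ 0) :
    ∫ r in Set.Ioc (-1 : ℝ) 0, (if r < c then (1 : ℝ) else 0) = c + 1 := by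
  have h1 : (fun r : ℝ => if r < c then (1 : ℝ) else 0) = (Set.Iio c).indicator fun _ => (1 : ℝ) := by
    funext r; simp only [Set.indicator_apply, Set.mem_Iio]
  have h2 : Set.Iio c ∩ Set.Ioc (-1 : ℝ) 0 = Set.Ioo (-1) c := by
    ext r
    simp only [Set.mem_inter_iff, Set.mem_Iio, Set.mem_Ioc, Set.mem_Ioo]
    constructor
    · rintro ⟨h, h', _⟩; exact ⟨h', h⟩
    · rintro ⟨h, h'⟩; exact ⟨h', h, by linarith⟩
  rw [h1, integral_indicator measurableSet_Iio, Measure.restrict_restrict measurableSet_Iio, integral_const, smul_eq_mul,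
    mul_one, measureReal_restrict_apply_univ, h2, Real.volume_real_Ioo_of_le (by linarith)]
  ring

/-- `r ↦ 1{r < c}` is integrable on `(-1, 0]`. [folklore] -/
theorem integrable_Ioc_ite_lt (c : ℝ) :
    Integrable (fun r : ℝ => if r < c then (1 : ℝ) else 0) (volume.restrict (Set.Ioc (-1 : ℝ) 0)) := by
  have h1 : (fun r : ℝ => if r < c then (1 : ℝ) else 0) = (Set.Iio c).indicator fun _ => (1 : ℝ) := by
    funext r; simp only [Set.indicator_apply, Set.mem_Iio]
  rw [h1]
  exact (integrable_const (1 : ℝ)).indicator measurableSet_Iio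

/-- **Blocking floor for the two-cluster repulsion (quantitative BHK Thm 1.4 / eq. (2); BENCH row M2-R11 (blk) AS TYPED, layer-cake form).**
Weights supported on the pair set `E`, `D = {s ↮ t}`, `s ≠ t`, vertices `a, o`, `φ = −P_{C_s}(t↔o) ∈ [−1, 0]` the blocking potential and
`H_r` the level-`r` hull event of `condCov_level_openConn_ge_blocking` (`φ ≤ r`, `a ∉ C_s`, every attached extension `U` of `C_s` with
`φ_U > r` contains `a`).  Then
  `∫_{r ∈ (−1, 0]} μ(D ∩ {φ > r})·μ(D ∩ H_r) dr ≤ μ(D ∩ {s↔a})·μ(D ∩ {t↔o}) − μ(D)·μ(D ∩ {s↔a} ∩ {t↔o})`,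
i.e. `−Cov(1{s↔a}, 1{t↔o} | s↮t) ≥ ∫ ν(φ > r)·ν(H_r) dr = Σ_r (r⁺ − r)·ν(φ > r)·ν(H_r)` (sum over consecutive values of `φ`; the integrand is
constant between them) — «blocking t ↔ o beyond level r forces absorbing a».  Proof: `−Cov_ν(1{s↔a}, 1{t↔o}) = Cov_ν(1{s↔a}, φ(C_s))` by BHK's
display (10), `φ + 1 = ∫_{(−1,0]} 1{φ > r} dr`, and the level floors `condCov_level_openConn_ge_blocking` integrated over `r`.
[cite: VandenbergHaggstromKahn2005, Thm. 1.4 and eq. (2) (pp. 2, 7), display (10) (p. 7)] -/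
theorem twoCluster_repulsion_openConn_ge_blocking (w : Sym2 V → unitInterval) (E : Set (Sym2 V))
    (hE : ∀ e, e ∉ E → (w e : ℝ) = 0) (s t a o : V) (hst : s ≠ t) :
    ∫ r in Set.Ioc (-1 : ℝ) 0,
      (prodBernoulli w).real ({ω : BondConfig V | ¬ (openGraph ω).Reachable s t} ∩
          {ω | r < -(prodBernoulli w).real {η : BondConfig V |
            (openGraph (η \ {e | ∃ v ∈ e, v ∈ openCluster ω s})).Reachable t o}}) *
        (prodBernoulli w).real ({ω : BondConfig V | ¬ (openGraph ω).Reachable s t} ∩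
          {ω | -(prodBernoulli w).real {η : BondConfig V |
                (openGraph (η \ {e | ∃ v ∈ e, v ∈ openCluster ω s})).Reachable t o} ≤ r ∧
              a ∉ openCluster ω s ∧
              ∀ U : Set V, (∀ u ∈ U, (openGraph {e | (e ∈ E ∧ t ∉ e) ∧
                  ∀ v ∈ e, v ∈ openCluster ω s ∨ v ∈ U}).Reachable s u) →
                r < -(prodBernoulli w).real {η : BondConfig V |
                  (openGraph (η \ {e | ∃ v ∈ e, v ∈ openCluster ω s ∨ v ∈ U})).Reachable t o} →
                a ∈ openCluster ω s ∨ a ∈ U}) ≤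
    (prodBernoulli w).real ({ω : BondConfig V | ¬ (openGraph ω).Reachable s t} ∩ openConn s a) *
        (prodBernoulli w).real ({ω : BondConfig V | ¬ (openGraph ω).Reachable s t} ∩ openConn t o) -
      (prodBernoulli w).real {ω : BondConfig V | ¬ (openGraph ω).Reachable s t} *
        (prodBernoulli w).real ({ω : BondConfig V | ¬ (openGraph ω).Reachable s t} ∩ openConn s a ∩ openConn t o) := by
  set μ := prodBernoulli w with hμ
  set w' : Sym2 V → ℝ := fun e => (w e : ℝ) with hw'
  set D : Set (BondConfig V) := {ω : BondConfig V | ¬ (openGraph ω).Reachable s t} with hD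
  have hmeas : ∀ S : Set (BondConfig V), MeasurableSet S := fun _ => MeasurableSet.of_discrete
  set P : Set V → ℝ := fun C => μ.real {η : BondConfig V |
    (openGraph (η \ {e | ∃ v ∈ e, v ∈ C})).Reachable t o} with hP
  set φ : BondConfig V → ℝ := fun ω => -P (openCluster ω s) with hφ
  set hull : ℝ → BondConfig V → Prop := fun r ω =>
    ∀ U : Set V, (∀ u ∈ U, (openGraph {e | (e ∈ E ∧ t ∉ e) ∧ ∀ v ∈ e, v ∈ openCluster ω s ∨ v ∈ U}).Reachable s u) →
      r < -(μ.real {η : BondConfig V | (openGraph (η \ {e | ∃ v ∈ e, v ∈ openCluster ω s ∨ v ∈ U})).Reachable t o}) →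
      a ∈ openCluster ω s ∨ a ∈ U with hhull
  set Lev : ℝ → Set (BondConfig V) := fun r => {ω | r < φ ω} with hLev
  set Hev : ℝ → Set (BondConfig V) := fun r => {ω | φ ω ≤ r ∧ a ∉ openCluster ω s ∧ hull r ω} with hHev
  set A : Set (BondConfig V) := openConn s a with hA
  set B : Set (BondConfig V) := openConn t o with hB
  -- the goal in this notation
  show ∫ r in Set.Ioc (-1 : ℝ) 0, μ.real (D ∩ Lev r) * μ.real (D ∩ Hev r) ≤
    μ.real (D ∩ A) * μ.real (D ∩ B) - μ.real D * μ.real (D ∩ A ∩ B)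
  -- the level floors
  have hlev : ∀ r, μ.real (D ∩ Lev r) * μ.real (D ∩ Hev r) ≤
      μ.real D * μ.real (D ∩ A ∩ Lev r) - μ.real (D ∩ Lev r) * μ.real (D ∩ A) := by
    intro r
    have h := condCov_level_openConn_ge_blocking w E hE s t a o hst r
    rw [← hμ] at h
    have h1 : D ∩ A ∩ Lev r = D ∩ Lev r ∩ A := Set.inter_right_comm D A (Lev r)
    rw [h1]
    exact h
  -- monotonicity in the level
  have hLev_anti : ∀ S : Set (BondConfig V), Antitone fun r => μ.real (S ∩ Lev r) := by
    intro S r r' h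
    exact measureReal_mono fun ω ⟨hS, hω⟩ => ⟨hS, lt_of_le_of_lt h hω⟩
  have hHev_mono : Monotone fun r => μ.real (D ∩ Hev r) := by
    intro r r' h
    refine measureReal_mono fun ω ⟨hS, h1, h2, h3⟩ => ⟨hS, h1.trans h, h2, fun U hU hr => h3 U hU (lt_of_le_of_lt h hr)⟩
  -- integrability on `(-1, 0]`
  have hK : IsCompact (Set.Icc (-1 : ℝ) 0) := isCompact_Icc
  have hint_anti : ∀ S : Set (BondConfig V),
      Integrable (fun r => μ.real (S ∩ Lev r)) (volume.restrict (Set.Ioc (-1 : ℝ) 0)) := fun S =>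
    (((hLev_anti S).antitoneOn _).integrableOn_isCompact hK).mono_set Set.Ioc_subset_Icc_self
  have hint_H : Integrable (fun r => μ.real (D ∩ Hev r)) (volume.restrict (Set.Ioc (-1 : ℝ) 0)) :=
    ((hHev_mono.monotoneOn _).integrableOn_isCompact hK).mono_set Set.Ioc_subset_Icc_self
  have hint_f : Integrable (fun r => μ.real (D ∩ Lev r) * μ.real (D ∩ Hev r)) (volume.restrict (Set.Ioc (-1 : ℝ) 0)) := by
    refine Integrable.bdd_mul (c := 1) hint_H (hint_anti D).aestronglyMeasurable (Filter.Eventually.of_forall fun r => ?_)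
    rw [Real.norm_eq_abs, abs_of_nonneg measureReal_nonneg]
    exact measureReal_le_one
  have hint_g : Integrable (fun r => μ.real D * μ.real (D ∩ A ∩ Lev r) - μ.real (D ∩ Lev r) * μ.real (D ∩ A))
      (volume.restrict (Set.Ioc (-1 : ℝ) 0)) :=
    ((hint_anti (D ∩ A)).const_mul _).sub ((hint_anti D).mul_const _)
  -- `∫ μ(S ∩ {φ > r}) dr = μ(S) - ∫_S P(C_s)`
  have hP01 : ∀ C, 0 ≤ P C ∧ P C ≤ 1 := fun C => ⟨measureReal_nonneg, measureReal_le_one⟩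
  have hI : ∀ S : Set (BondConfig V), ∫ r in Set.Ioc (-1 : ℝ) 0, μ.real (S ∩ Lev r) =
      μ.real S - ∫ ω in S, P (openCluster ω s) ∂μ := by
    intro S
    have h1 : ∀ r, μ.real (S ∩ Lev r) = ∑ ω, weight w' ω * ((if r < φ ω then (1 : ℝ) else 0) * ind S ω) := by
      intro r
      rw [← setIntegral_eq_sum_weight w S]
      have h2 : (fun ω : BondConfig V => if r < φ ω then (1 : ℝ) else 0) = (Lev r).indicator fun _ => (1 : ℝ) := by
        funext ω; simp only [hLev, Set.indicator_apply, Set.mem_setOf_eq]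
      rw [h2, integral_indicator (hmeas _), Measure.restrict_restrict (hmeas _), integral_const, smul_eq_mul, mul_one,
        measureReal_restrict_apply_univ, Set.inter_comm]
    simp_rw [h1]
    rw [integral_finsetSum _ fun ω _ => ((integrable_Ioc_ite_lt (φ ω)).mul_const _).const_mul _]
    have h3 : ∀ ω, ∫ r in Set.Ioc (-1 : ℝ) 0, weight w' ω * ((if r < φ ω then (1 : ℝ) else 0) * ind S ω) =
        weight w' ω * ((φ ω + 1) * ind S ω) := by
      intro ω
      rw [integral_const_mul, integral_mul_const, integral_Ioc_ite_lt_eq (φ ω)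
        (by simp only [hφ]; linarith [(hP01 (openCluster ω s)).2]) (by simp only [hφ]; linarith [(hP01 (openCluster ω s)).1])]
    simp_rw [h3]
    have h4 : ∀ ω, weight w' ω * ((φ ω + 1) * ind S ω) =
        weight w' ω * ((1 : ℝ) * ind S ω) - weight w' ω * (P (openCluster ω s) * ind S ω) := by
      intro ω; simp only [hφ]; ring
    simp_rw [h4]
    rw [Finset.sum_sub_distrib, ← setIntegral_eq_sum_weight w S, ← setIntegral_eq_sum_weight w S, integral_const, smul_eq_mul,
      mul_one, measureReal_restrict_apply_univ]
  -- display (10): `∫_D P(C_s) = μ(D ∩ {t↔o})` and `∫_{D ∩ {s↔a}} P(C_s) = μ(D ∩ {s↔a} ∩ {t↔o})`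
  have hspan : ∀ (ζ : BondConfig V) (x y : V), (y = x ∨ ∃ e' ∈ openEdgeCluster ζ x, y ∈ e') ↔ y ∈ openCluster ζ x := by
    intro ζ x y; rw [KNPreFKG.openCluster_eq_setOf_openEdgeCluster]; rfl
  have hm : ∑ ω, weight w' ω = 1 := by
    have h1 := integral_prodBernoulli_eq_sum w fun _ => (1 : ℝ)
    simp only [integral_const, probReal_univ, smul_eq_mul, mul_one] at h1
    exact h1.symm
  set g : Set (Sym2 V) → ℝ := fun K => if (o = t ∨ ∃ e' ∈ K, o ∈ e') then 1 else 0 with hg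
  set Fa : Set (Sym2 V) → ℝ := fun W => if (a = s ∨ ∃ e' ∈ W, a ∈ e') then 1 else 0 with hFa
  have hres : ∀ ω : BondConfig V, ∑ η, weight w' η * g (openEdgeCluster
      (η \ {e | ∃ v ∈ e, v = s ∨ ∃ e' ∈ openEdgeCluster ω s, v ∈ e'}) t) = P (openCluster ω s) := by
    intro ω
    have hBC : {e : Sym2 V | ∃ v ∈ e, v = s ∨ ∃ e' ∈ openEdgeCluster ω s, v ∈ e'} = {e | ∃ v ∈ e, v ∈ openCluster ω s} := by
      ext e; simp only [Set.mem_setOf_eq, hspan ω s]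
    rw [hBC]
    simp only [hP]
    rw [← integral_indicator_one (hmeas _), integral_prodBernoulli_eq_sum]
    refine Finset.sum_congr rfl fun η _ => ?_
    congr 1
    simp only [hg, hspan _ t o, Set.indicator_apply, Set.mem_setOf_eq, Pi.one_apply]
    rfl
  have h10 : ∀ Fv : Set (Sym2 V) → ℝ, ∫ ω in D, Fv (openEdgeCluster ω s) * P (openCluster ω s) ∂μ =
      ∫ ω in D, Fv (openEdgeCluster ω s) * g (openEdgeCluster ω t) ∂μ := by
    intro Fv
    have hD' : ∀ ω, ω ∈ D ↔ ¬ (openGraph ω).Reachable s t := fun ω => Iff.rfl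
    rw [setIntegral_eq_sum_weight, setIntegral_eq_sum_weight, sum_cond_cluster w' hm s t (fun C K => Fv C * g K) hD']
    refine Finset.sum_congr rfl fun ω _ => ?_
    rw [← hres ω, Finset.mul_sum]
    congr 2
    refine Finset.sum_congr rfl fun η _ => ?_
    ring
  have hind : ∀ (f : BondConfig V → ℝ) (T : Set (BondConfig V)), (∀ ω, f ω = if ω ∈ T then (1 : ℝ) else 0) →
      ∫ ω in D, f ω ∂μ = μ.real (D ∩ T) := by
    intro f T hf
    have h1 : f = T.indicator fun _ => (1 : ℝ) := by funext ω; rw [hf ω, Set.indicator_apply]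
    rw [h1, integral_indicator (hmeas T), Measure.restrict_restrict (hmeas T), integral_const, smul_eq_mul, mul_one,
      Set.inter_comm, measureReal_restrict_apply_univ]
  have hDB : ∫ ω in D, P (openCluster ω s) ∂μ = μ.real (D ∩ B) := by
    have h1 := h10 fun _ => 1
    simp only [one_mul] at h1
    rw [h1]
    refine hind _ B fun ω => ?_
    simp only [hg, hspan ω t o]
    exact if_congr Iff.rfl rfl rfl
  have hDAB : ∫ ω in D ∩ A, P (openCluster ω s) ∂μ = μ.real (D ∩ A ∩ B) := by
    have h1 : ∫ ω in D ∩ A, P (openCluster ω s) ∂μ = ∫ ω in D, Fa (openEdgeCluster ω s) * P (openCluster ω s) ∂μ := by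
      have h2 : (fun ω : BondConfig V => Fa (openEdgeCluster ω s) * P (openCluster ω s)) =
          A.indicator fun ω => P (openCluster ω s) := by
        funext ω
        by_cases h : a ∈ openCluster ω s
        · rw [Set.indicator_of_mem (show ω ∈ A from h)]
          simp only [hFa, hspan ω s a, if_pos h, one_mul]
        · rw [Set.indicator_of_notMem (show ω ∉ A from h)]
          simp only [hFa, hspan ω s a, if_neg h, zero_mul]
      rw [h2, integral_indicator (hmeas A), Measure.restrict_restrict (hmeas A), Set.inter_comm]
    rw [h1, h10 Fa, Set.inter_assoc]
    refine hind _ (A ∩ B) fun ω => ?_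
    simp only [hFa, hg, hspan ω s a, hspan ω t o]
    by_cases h1 : a ∈ openCluster ω s
    · by_cases h2 : o ∈ openCluster ω t
      · rw [if_pos h1, if_pos h2, one_mul, if_pos (show ω ∈ A ∩ B from ⟨h1, h2⟩)]
      · rw [if_pos h1, if_neg h2, one_mul, if_neg (show ω ∉ A ∩ B from fun h => h2 h.2)]
    · rw [if_neg h1, zero_mul, if_neg (show ω ∉ A ∩ B from fun h => h1 h.1)]
  -- assemble
  have hIg : ∫ r in Set.Ioc (-1 : ℝ) 0, (μ.real D * μ.real (D ∩ A ∩ Lev r) - μ.real (D ∩ Lev r) * μ.real (D ∩ A)) =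
      μ.real D * (μ.real (D ∩ A) - μ.real (D ∩ A ∩ B)) - (μ.real D - μ.real (D ∩ B)) * μ.real (D ∩ A) := by
    rw [integral_sub ((hint_anti (D ∩ A)).const_mul _) ((hint_anti D).mul_const _), integral_const_mul, integral_mul_const,
      hI (D ∩ A), hI D, hDB, hDAB]
  calc ∫ r in Set.Ioc (-1 : ℝ) 0, μ.real (D ∩ Lev r) * μ.real (D ∩ Hev r)
      ≤ ∫ r in Set.Ioc (-1 : ℝ) 0, (μ.real D * μ.real (D ∩ A ∩ Lev r) - μ.real (D ∩ Lev r) * μ.real (D ∩ A)) :=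
        integral_mono hint_f hint_g hlev
    _ = _ := hIg
    _ ≤ _ := le_of_eq (by ring)

end QuantBHK

end Summit.CriticalPhenomena.PercolationContinuityZ3.Theorems
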